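import Mathlib
import HarnessLib
import Summits.CriticalPhenomena.PercolationContinuityZ3.Theorems.PercNearOneGluingNoHeavyQuantFarDecLawBounds

/-!
# QUANT lane R8, front "FAR beyond trees", layer one — CYC-DEC at the law level, file 3: THE AGGREGATES
# (recursions of `PE, PS, DN, GZ, GS` along `shift`, their ranges, and the ranges of the block numbers)

builds on p205010 (kernel theorem, internal audit signed; external expert review pending)

Support file (`--supports stmt-CriticalPhenomena-4575`), seat `prim-quant-p1` (gen 21); memo
`run/shared/lean/prim/quant/prim-quant-p1-g21/FOR-LEAD-CYCDEC.md` §3, §6(2)–(3).  Standard axioms; no sorries; no definitions.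

For a `TwoChain` `C` with `n + 1` hubs and `D = C.shift` (hubs `2..n+1`): `ZF (n+1) C = z₁·ZF n D`, `SF (n+1) C = s₁ZF n D + z₁SF n D`
(definitional) and the five aggregate recursions (peel the position `f = 1` of the right arm and shift the rest)
`PE (n+1) C = (B₂ − B₁)·ZF n D + PE n D`, `PS (n+1) C = (B₂ − B₁)·SF n D + PS n D`,
`DN (n+1) C = (B₂ − B₁)·ZF n D·A₁u₁ + A₁u₁·PE n D + z₁·DN n D`,
`GZ (n+1) C = (B₂ − B₁)·ZF n D·A₁d₁ + A₁d₁·PE n D + s₁·DN n D + z₁·GZ n D`,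
`GS (n+1) C = (B₂ − B₁)·SF n D·A₁u₁ + A₁u₁·PS n D + z₁·GS n D`;
ranges `0 ≤ PE, PS, DN, GZ, GS`, `DN ≤ A₁·PE`, `GZ ≤ DN`, `GS ≤ A₁·PS`, `PE + PS ≤ 1 − B₁`, the per-position comparison
`ZQ·g2 + SQ·g1 + Dq ≤ D2all` and `ZF n ≤ ZQ·(1 − g1)`, and the ranges of the numbers: `0 ≤ TT ≤ 1 − omH`, `omH ≥ ZF n ≥ 0`,
`TT ≤ 1 − ZF n − SF n`.  (Checked against brute force: `num/rec_defs.py`.)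
[this work]
-/

namespace Summit.CriticalPhenomena.PercolationContinuityZ3.Theorems

namespace Quant

namespace Block

namespace TwoChain

open Finset

variable {C : TwoChain} {N : ℕ}

section Recursions

variable (C : TwoChain) (n : ℕ)

/-- `PE (n+1) C = (B₂ − B₁)·ZF n D + PE n D`. [this work] -/
theorem PE_succ : PE (n + 1) C = (C.B 2 - C.B 1) * ZF n C.shift + PE n C.shift := by
  have e0 : C.w (0 + 1) * ZQ (n + 1) (0 + 1) C = (C.B 2 - C.B 1) * ZF n C.shift := by
    rw [ZQ_succ_succ, ZQ_zero_right]; rfl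
  have e : ∀ f : ℕ, C.w (f + 1 + 1) * ZQ (n + 1) (f + 1 + 1) C = C.shift.w (f + 1) * ZQ n (f + 1) C.shift := by
    intro f; rw [ZQ_succ_succ, shift_w]
  unfold PE
  rw [sum_range_succ', e0, sum_congr rfl (fun f _ => e f)]
  ring

/-- `PS (n+1) C = (B₂ − B₁)·SF n D + PS n D`. [this work] -/
theorem PS_succ : PS (n + 1) C = (C.B 2 - C.B 1) * SF n C.shift + PS n C.shift := by
  have e0 : C.w (0 + 1) * SQ (n + 1) (0 + 1) C = (C.B 2 - C.B 1) * SF n C.shift := by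
    rw [SQ_succ_succ, SQ_zero_right]; rfl
  have e : ∀ f : ℕ, C.w (f + 1 + 1) * SQ (n + 1) (f + 1 + 1) C = C.shift.w (f + 1) * SQ n (f + 1) C.shift := by
    intro f; rw [SQ_succ_succ, shift_w]
  unfold PS
  rw [sum_range_succ', e0, sum_congr rfl (fun f _ => e f)]
  ring

/-- `DN (n+1) C = (B₂ − B₁)·ZF n D·A₁u₁ + A₁u₁·PE n D + z₁·DN n D`. [this work] -/
theorem DN_succ : DN (n + 1) C = (C.B 2 - C.B 1) * ZF n C.shift * (C.A 1 * C.u 1)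
    + C.A 1 * C.u 1 * PE n C.shift + C.z 1 * DN n C.shift := by
  have e0 : C.w (0 + 1) * ZQ (n + 1) (0 + 1) C * g1 (0 + 1) C = (C.B 2 - C.B 1) * ZF n C.shift * (C.A 1 * C.u 1) := by
    rw [ZQ_succ_succ, ZQ_zero_right, g1_succ, g1_zero, mul_zero, add_zero]; rfl
  have e : ∀ f : ℕ, C.w (f + 1 + 1) * ZQ (n + 1) (f + 1 + 1) C * g1 (f + 1 + 1) C
      = C.A 1 * C.u 1 * (C.shift.w (f + 1) * ZQ n (f + 1) C.shift)
        + C.z 1 * (C.shift.w (f + 1) * ZQ n (f + 1) C.shift * g1 (f + 1) C.shift) := by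
    intro f; rw [ZQ_succ_succ, g1_succ, shift_w]; ring
  unfold DN PE
  rw [sum_range_succ', e0, sum_congr rfl (fun f _ => e f), sum_add_distrib, ← mul_sum, ← mul_sum]
  ring

/-- `GZ (n+1) C = (B₂ − B₁)·ZF n D·A₁d₁ + A₁d₁·PE n D + s₁·DN n D + z₁·GZ n D`. [this work] -/
theorem GZ_succ : GZ (n + 1) C = (C.B 2 - C.B 1) * ZF n C.shift * (C.A 1 * C.d 1)
    + C.A 1 * C.d 1 * PE n C.shift + C.s 1 * DN n C.shift + C.z 1 * GZ n C.shift := by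
  have e0 : C.w (0 + 1) * ZQ (n + 1) (0 + 1) C * g2 (0 + 1) C = (C.B 2 - C.B 1) * ZF n C.shift * (C.A 1 * C.d 1) := by
    rw [ZQ_succ_succ, ZQ_zero_right, g2_succ, g2_zero, g1_zero, mul_zero, mul_zero, add_zero, add_zero]; rfl
  have e : ∀ f : ℕ, C.w (f + 1 + 1) * ZQ (n + 1) (f + 1 + 1) C * g2 (f + 1 + 1) C
      = C.A 1 * C.d 1 * (C.shift.w (f + 1) * ZQ n (f + 1) C.shift)
        + C.s 1 * (C.shift.w (f + 1) * ZQ n (f + 1) C.shift * g1 (f + 1) C.shift)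
        + C.z 1 * (C.shift.w (f + 1) * ZQ n (f + 1) C.shift * g2 (f + 1) C.shift) := by
    intro f; rw [ZQ_succ_succ, g2_succ, shift_w]; ring
  unfold GZ DN PE
  rw [sum_range_succ', e0, sum_congr rfl (fun f _ => e f), sum_add_distrib, sum_add_distrib, ← mul_sum, ← mul_sum, ← mul_sum]
  ring

/-- `GS (n+1) C = (B₂ − B₁)·SF n D·A₁u₁ + A₁u₁·PS n D + z₁·GS n D`. [this work] -/
theorem GS_succ : GS (n + 1) C = (C.B 2 - C.B 1) * SF n C.shift * (C.A 1 * C.u 1)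
    + C.A 1 * C.u 1 * PS n C.shift + C.z 1 * GS n C.shift := by
  have e0 : C.w (0 + 1) * SQ (n + 1) (0 + 1) C * g1 (0 + 1) C = (C.B 2 - C.B 1) * SF n C.shift * (C.A 1 * C.u 1) := by
    rw [SQ_succ_succ, SQ_zero_right, g1_succ, g1_zero, mul_zero, add_zero]; rfl
  have e : ∀ f : ℕ, C.w (f + 1 + 1) * SQ (n + 1) (f + 1 + 1) C * g1 (f + 1 + 1) C
      = C.A 1 * C.u 1 * (C.shift.w (f + 1) * SQ n (f + 1) C.shift)
        + C.z 1 * (C.shift.w (f + 1) * SQ n (f + 1) C.shift * g1 (f + 1) C.shift) := by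
    intro f; rw [SQ_succ_succ, g1_succ, shift_w]; ring
  unfold GS PS
  rw [sum_range_succ', e0, sum_congr rfl (fun f _ => e f), sum_add_distrib, ← mul_sum, ← mul_sum]
  ring

end Recursions

/-- `0 ≤ PE`. [this work] -/
theorem PE_nonneg (h : C.Valid N) (n : ℕ) : 0 ≤ PE n C :=
  sum_nonneg (fun _ _ => mul_nonneg (w_nonneg h _) (ZQ_nonneg h _ _))

/-- `0 ≤ PS`. [this work] -/
theorem PS_nonneg (h : C.Valid N) (n : ℕ) : 0 ≤ PS n C :=
  sum_nonneg (fun _ _ => mul_nonneg (w_nonneg h _) (SQ_nonneg h _ _))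

/-- `0 ≤ DN`. [this work] -/
theorem DN_nonneg (h : C.Valid N) (n : ℕ) : 0 ≤ DN n C :=
  sum_nonneg (fun _ _ => mul_nonneg (mul_nonneg (w_nonneg h _) (ZQ_nonneg h _ _)) (g1_nonneg h _))

/-- `0 ≤ GZ`. [this work] -/
theorem GZ_nonneg (h : C.Valid N) (n : ℕ) : 0 ≤ GZ n C :=
  sum_nonneg (fun _ _ => mul_nonneg (mul_nonneg (w_nonneg h _) (ZQ_nonneg h _ _)) (g2_nonneg h _))

/-- `0 ≤ GS`. [this work] -/
theorem GS_nonneg (h : C.Valid N) (n : ℕ) : 0 ≤ GS n C :=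
  sum_nonneg (fun _ _ => mul_nonneg (mul_nonneg (w_nonneg h _) (SQ_nonneg h _ _)) (g1_nonneg h _))

/-- `DN ≤ A₁·PE` (`g1 ≤ A₁`). [this work] -/
theorem DN_le (h : C.Valid N) (n : ℕ) : DN n C ≤ C.A 1 * PE n C := by
  unfold DN PE
  rw [mul_sum]
  apply sum_le_sum; intro f _
  have h0 : 0 ≤ C.w (f + 1) * ZQ n (f + 1) C := mul_nonneg (w_nonneg h _) (ZQ_nonneg h _ _)
  have := mul_le_mul_of_nonneg_left (g1_le_A h (f + 1)) h0
  linarith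

/-- `DN ≤ PE` (`g1 ≤ 1`). [this work] -/
theorem DN_le_PE (h : C.Valid N) (n : ℕ) : DN n C ≤ PE n C := by
  have := DN_le h n
  nlinarith [PE_nonneg h n, h.A_le_one 1]

/-- `GZ ≤ DN` (`g2 ≤ g1`). [this work] -/
theorem GZ_le_DN (h : C.Valid N) (n : ℕ) : GZ n C ≤ DN n C := by
  unfold GZ DN
  apply sum_le_sum; intro f _
  exact mul_le_mul_of_nonneg_left (g2_le_g1 h (f + 1)) (mul_nonneg (w_nonneg h _) (ZQ_nonneg h _ _))

/-- `GS ≤ A₁·PS`. [this work] -/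
theorem GS_le (h : C.Valid N) (n : ℕ) : GS n C ≤ C.A 1 * PS n C := by
  unfold GS PS
  rw [mul_sum]
  apply sum_le_sum; intro f _
  have h0 : 0 ≤ C.w (f + 1) * SQ n (f + 1) C := mul_nonneg (w_nonneg h _) (SQ_nonneg h _ _)
  have := mul_le_mul_of_nonneg_left (g1_le_A h (f + 1)) h0
  linarith

/-- `GS ≤ PS`. [this work] -/
theorem GS_le_PS (h : C.Valid N) (n : ℕ) : GS n C ≤ PS n C := by
  have := GS_le h n
  nlinarith [PS_nonneg h n, h.A_le_one 1]

/-- `PE + PS ≤ Σ w = 1 − B₁` (for a system valid with `n` hubs). [this work] -/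
theorem PE_add_PS_le {n : ℕ} (h : C.Valid n) : PE n C + PS n C ≤ 1 - C.B 1 := by
  rw [← sum_w h]
  unfold PE PS
  rw [← sum_add_distrib]
  apply sum_le_sum; intro f _
  have := ZQ_add_SQ_le_one h n (f + 1)
  have hw := w_nonneg h (f + 1)
  nlinarith

/-- Per position: `ZQ·g2 + SQ·g1 + Dq ≤ D2all` (`g2 ≤ DF`, `g1 ≤ 1 − ZF`; `D2all` split at the position). [this work] -/
theorem d_le_D2all (h : C.Valid N) {n f : ℕ} (hf : f + 1 ≤ n) :
    ZQ n (f + 1) C * g2 (f + 1) C + SQ n (f + 1) C * g1 (f + 1) C + (1 - ZQ n (f + 1) C - SQ n (f + 1) C)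
      ≤ 1 - ZF n C - SF n C := by
  rw [ZF_split n (f + 1) hf C, SF_split n (f + 1) hf C]
  have hZq := ZQ_nonneg h n (f + 1)
  have hSq := SQ_nonneg h n (f + 1)
  have e1 : g1 (f + 1) C ≤ 1 - ZF (f + 1) C := by
    have := g1_le h (f + 1)
    nlinarith [h.A_le_one 1, ZF_le_one h (f + 1)]
  have e2 : g2 (f + 1) C ≤ 1 - ZF (f + 1) C - SF (f + 1) C := by
    have := g2_le h (f + 1)
    nlinarith [h.A_le_one 1, ZF_add_SF_le_one h (f + 1)]
  have t1 := mul_le_mul_of_nonneg_left e2 hZq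
  have t2 := mul_le_mul_of_nonneg_left e1 hSq
  nlinarith

/-- Per position: `ZF n ≤ ZQ·(1 − g1)` (`g1 ≤ 1 − ZF` of the free zone). [this work] -/
theorem ZF_le_b (h : C.Valid N) {n f : ℕ} (hf : f + 1 ≤ n) :
    ZF n C ≤ ZQ n (f + 1) C * (1 - g1 (f + 1) C) := by
  rw [ZF_split n (f + 1) hf C]
  apply mul_le_mul_of_nonneg_left _ (ZQ_nonneg h n (f + 1))
  have := g1_le h (f + 1)
  nlinarith [h.A_le_one 1, ZF_le_one h (f + 1)]

/-- `TT ≤ D2all = 1 − ZF n − SF n` (sum of `d_le_D2all`). [this work] -/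
theorem TT_le_D2all {n : ℕ} (h : C.Valid n) : TT n C ≤ 1 - ZF n C - SF n C := by
  unfold TT
  -- Σ w (ZQ g2 + SQ g1 + Dq) ≤ Σ w · D2all = (1 − B₁) D2all
  have key : GZ n C + GS n C + (1 - C.B 1) - PE n C - PS n C ≤ (1 - C.B 1) * (1 - ZF n C - SF n C) := by
    rw [← sum_w h]
    unfold GZ GS PE PS
    have : ∑ f ∈ range n, C.w (f + 1) * (ZQ n (f + 1) C * g2 (f + 1) C + SQ n (f + 1) C * g1 (f + 1) C
        + (1 - ZQ n (f + 1) C - SQ n (f + 1) C)) ≤ ∑ f ∈ range n, C.w (f + 1) * (1 - ZF n C - SF n C) := by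
      apply sum_le_sum; intro f hf
      exact mul_le_mul_of_nonneg_left (d_le_D2all h (by simpa using hf)) (w_nonneg h _)
    rw [← sum_mul] at this
    have e : ∑ f ∈ range n, C.w (f + 1) * (ZQ n (f + 1) C * g2 (f + 1) C + SQ n (f + 1) C * g1 (f + 1) C
        + (1 - ZQ n (f + 1) C - SQ n (f + 1) C))
        = (∑ f ∈ range n, C.w (f + 1) * ZQ n (f + 1) C * g2 (f + 1) C) + (∑ f ∈ range n, C.w (f + 1) * SQ n (f + 1) C * g1 (f + 1) C)
          + (∑ f ∈ range n, C.w (f + 1)) - (∑ f ∈ range n, C.w (f + 1) * ZQ n (f + 1) C)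
          - (∑ f ∈ range n, C.w (f + 1) * SQ n (f + 1) C) := by
      rw [← sum_add_distrib, ← sum_add_distrib, ← sum_sub_distrib, ← sum_sub_distrib]
      apply sum_congr rfl; intro f _; ring
    linarith
  nlinarith [h.B_nonneg 1]

/-- `0 ≤ TT`. [this work] -/
theorem TT_nonneg {n : ℕ} (h : C.Valid n) : 0 ≤ TT n C := by
  unfold TT
  have e : GZ n C + GS n C + (1 - C.B 1) - PE n C - PS n C ≥ 0 := by
    linarith [GZ_nonneg h n, GS_nonneg h n, PE_add_PS_le h]
  have := ZF_add_SF_le_one h n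
  nlinarith [h.B_nonneg 1]

/-- `ZF n ≤ omH` (no unit anywhere ⟹ nothing delivered); in particular `0 ≤ omH`. [this work] -/
theorem ZF_le_omH {n : ℕ} (h : C.Valid n) : ZF n C ≤ omH n C := by
  unfold omH
  -- (1 − B₁) ZF = Σ w ZF ≤ Σ w ZQ (1 − g1) = PE − DN
  have key : (1 - C.B 1) * ZF n C ≤ PE n C - DN n C := by
    rw [← sum_w h, sum_mul]
    unfold PE DN
    rw [← sum_sub_distrib]
    apply sum_le_sum; intro f hf
    have := mul_le_mul_of_nonneg_left (ZF_le_b h (n := n) (f := f) (by simpa using hf)) (w_nonneg h (f + 1))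
    linarith
  linarith

/-- `0 ≤ omH`. [this work] -/
theorem omH_nonneg {n : ℕ} (h : C.Valid n) : 0 ≤ omH n C := le_trans (ZF_nonneg h n) (ZF_le_omH h)

/-- `TT ≤ 1 − omH` (i.e. `t ≤ h`): `1 − omH − TT = B₁·SF n + PS + (DN − GZ) − GS ≥ 0`. [this work] -/
theorem TT_le {n : ℕ} (h : C.Valid n) : TT n C ≤ 1 - omH n C := by
  unfold TT omH
  have := GZ_le_DN h n
  have := GS_le_PS h n
  nlinarith [h.B_nonneg 1, SF_nonneg h n]

end TwoChain

end Block

end Quant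

end Summit.CriticalPhenomena.PercolationContinuityZ3.Theorems
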